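/-
Copyright (c) 2026 the pub-hodgecm-mathlib formalisation cell (harness21).  Prover seat hodgecm-mathlib-LH5-p03 (g7); dealer LH4-plan (g7) WORDS #48∕#52 ((C5)′
«θ̄ = 1 VALUE», regime datum (V2)), 2026-09-02.  Count-neutral LAYER C of the dyadic (D-UNR) column; CENSUS-C5 bd72510a61456e21 row `ValueThetaOne` (+ `Closed`).
-/
import Literature.NumberTheory.Rogawski1990.UnitOrbitalIntegralInertCountJPosClosedTrace     -- (C5)′ JPos «package» (LH5-p05 (g6) over LH3-p01 (g7)): `natCard_cosets_traceTorus_eq_iTen_of_rel_of_package`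
import Literature.NumberTheory.Rogawski1990.UnitOrbitalIntegralInertCountJPosVanishingTrace  -- ★ p852062 (LH5-p05 (g6)): `natCard_cosets_traceTorus_eq_zero_of_lt`
import Literature.NumberTheory.Rogawski1990.UnitOrbitalIntegralInertValueThetaOneClosed      -- ★ (A-p03): `subgroupOf_flickerHK_eq` (u-generic), brings ★ `…Reindex`, ★ `…ValuesTheta`
import Literature.NumberTheory.Automorphic.UnitaryThreeFixedPointsCountTraceTorus             -- ★ p852026 C4-2 (this seat): Cor. 9 at the trace torus
import Literature.NumberTheory.Automorphic.UnitOrbitalIntegralUnfoldingHKTrace                -- ★ p851996 (C0a) (F0P2-p02 (g21)): Prop. 5 unfolding for `u_m^{(y,z)}`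
import Literature.NumberTheory.Automorphic.UnitaryThreePHTowerPackageTrace                   -- ★ p852072 C2-C (LH5-p05 (g6)): Prop. 8 (ii) numbers for `u_m^{(y,z)}`
import HarnessLib

/-!
# LAYER C, `θ̄ = 1`, TRACE FRAME: `#{q ∈ U⧸K : t q = q} = phiOne q Np N` for the trace torus block `t = M_{b,ϖ,ϖ⁻¹}(x₁,x₂,x₃)` under the (V2) regime datum — every
# residue characteristic (Flicker 1998 Prop. 5 p. 82, Cor. 9 p. 85, Prop. 10 pp. 85–86, Prop. 11 p. 87)

Topic `NumberTheory/Rogawski1990`; namespace `Literature.NumberTheory.Automorphic.UnitaryGroup`.  THEOREMS ONLY (no definition, no instance, no notation, no named fact, no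
`sorry`); kernel lane `--supports stmt-HodgeConjecture-24833`; count-neutral ((D-UNR) stays PRINT by D74′).  Cell `pub/hodgecm-mathlib`, crux H413 =
`stmt-HodgeConjecture-24833`; LH4 board LAYER C (C5)′, dealer LH4-plan (g7) WORD #48 (deal) ∕ #50–#52 (ruling (V2)); CENSUS-C5 bd72510a61456e21 (LH3-p02 (g6)) §2 rows
`ValueThetaOne` + `ValueThetaOneClosed` (MERGED here), CENSUS-Corner1 3c5cb185f847c933 (F0P3a-p02 (g23)) §2 (the consumer's ask).

THE TWIN.  ★ `UnitOrbitalIntegralInertValueThetaOne{,Closed}` (A-p03) prove `#Fix_{U⧸K}(t_ϖ(a,b,c)) = phiOne q N₊ N` for Flicker's torus literal (`2e = 1`, `yσy = −2`,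
`|2| = 1` through `LocalConjDatum`).  Here: the SAME value for ★ F1 p851889's trace torus block `t = !![x₁σb + x₃b, 0, θ(x₁ − x₃); 0, x₂, 0; θ′bσb(x₁ − x₃), 0, x₁b + x₃σb]`
(`b + σb = 1`, `|b| ≤ 1`, `θ = ϖ`, `θ′ = ϖ⁻¹`, norm-one `xᵢ`), the 2-free level elements `u_m^{(yℓ,zℓ)}` (`zℓ + σzℓ + yℓσyℓ = 0`, `|yℓ| = 1`, `|zℓ| ≤ 1`) of ★ p851802∕p851996,
the T1 bridge generator `gR` (`σR gR − gR ∈ Rˣ`) and the datum `UnramifiedLocalConjDatum σ ϖ` + `(2 : K) ≠ 0` (T2).  Invariants: `N = ord(x₁ − x₃)` and the DIAGONAL DEFECT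
`E = (x₁ − x₂)σb + (x₃ − x₂)b` (= `A − x₂` for the `(0,0)` entry `A`).
THE (V2) REGIME DATUM (LH4-plan WORD #50∕#52, one contract for both `θ̄`): instead of ★'s `(hNp : |a + c − 2b| = |ϖ^{N₊}|)` the head takes
`h : (N₁ < N ∧ N₂ = N₁ ∧ Np = N₁ ∧ |E| = |ϖ^{N₁}|) ∨ (N ≤ N₁ ∧ N ≤ Np ∧ |E| ≤ |ϖ^N|)` — TYPE A (the defect has exact order `Np = N₁ < N`; Flicker's fourth regime lives
here) or TYPE B (`N ≤ Np`, `|E| ≤ |ϖ^N|`, the `E = 0` family included).  TYPE A runs ★'s path verbatim over the (C5)′ JPos package head (LH3-p01 (g7) ∕ LH5-p05 (g6)); TYPE B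
NEVER reads an exact order of `E` (§1): with `ν = N − j < N ≤ Np` the Prop-10 cell is `m = 0 ↦ 1`, `ν < m ↦ 0`, `2m ≤ ν ↦` the full index, `m ≤ ν < 2m ↦ 0` («`|B₂|`
dominates», `max(|A − x₂|, |D − x₂|) < |B₂|`), each by a ★ (C3c) count (F0P3a-p09 (g9)) — which is `iTen q ν Np m` on the nose because `ν = Np` and `Np < m` are excluded.  So
the STOP-clause of WORD #52 («if a type-B body needs `|E| = |ϖ^{Np}|`») does not trigger.
* §1 `natCard_cosets_eq_iTen_of_rel_of_le` (generic trace corner, TYPE B dispatcher: `|A − b| ≤ |ϖ^N|`, `ν < N ≤ Np`; Prop. 8's index as hypotheses) and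
  `natCard_cosets_traceTorus_eq_iTen_of_rel_of_le` (at the trace literal `M_{b,π₁,π₁′}` with a free level `|π₁| = |ϖ^j|`, `1 ≤ j ≤ N`; Prop. 8's numbers DISCHARGED by ★ C2-C
  p852072).
* §2 **`natCard_fixedPoints_unitaryInt_traceTorusPi_eq_phiOne_of_bridge`** — the θ̄ = 1 VALUE: Prop. 5 unfolding (★ (C0a) `natCard_fixedPoints_unitaryInt_eq_finsum_flickerU_of_rel`),
  Cor. 9 at the trace torus (★ C4-2 `natCard_fixedPoints_traceTorus_eq_finsum`, Flicker's weights verbatim), the cells (TYPE A: (C5)′ `natCard_cosets_traceTorus_eq_iTen_of_rel_of_package`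
  at the radial conjugate ★ `coe_radial_inv_mul_traceTorusBlock_mul_radial`; TYPE B: §1), the vanishing beyond `j = N` (★ `natCard_cosets_traceTorus_eq_zero_of_lt`), the
  re-indexing `j = 2i + 1` (★ `finsum_comp_two_mul_add_one_eq_finsum_ite`) and the `Σᶠ`-identity ★ `finsum_natCast_eq_phiOne` — conclusion `phiOne q Np N` VERBATIM (the
  consumer: F0P3a-p02 (g23)'s `…ValueThetaOneCornerTrace`, then the EXPORT `…ValueThetaOneAdicCompletionTrace` and the (C6) reader contract ★ p851882 `hCPi`).
HONEST READER LABEL: HC_CM is proved only modulo the 7 printed citations (2 remaining named inputs: hLiu418 = `stmt-HodgeConjecture-24832`, h413 = `stmt-HodgeConjecture-24833`)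
until rung 0 closes; count-neutral, pays no organ, opens no road.

## References
* [Flicker1998UnitaryFL] Y. Z. Flicker, *Elementary proof of the fundamental lemma for a unitary group*, Canad. J. Math. 50 (1998), 74–98: Prop. 5 p. 82, Cor. 9 p. 85,
  Prop. 10 pp. 85–86, Prop. 11 p. 87.
* [Rogawski1990] J. D. Rogawski, *Automorphic Representations of Unitary Groups in Three Variables* (1990), §4.9 p. 55.
-/

set_option autoImplicit false

open scoped MatrixGroups WithZero Valued
open Matrix

universe u

namespace Literature.NumberTheory.Automorphic

namespace UnitaryGroup

open Literature.NumberTheory.Automorphic.HermitianLattice (unitaryInt mem_unitaryInt_iff UnramifiedLocalConjDatum)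
open Literature.NumberTheory.Rogawski1990.Flicker1998 (iTen phiOne corNineWeight)
open IsLocalRing

variable {K : Type*} [Field K] [Valued K ℤᵐ⁰] {ϖ : K} (σ : K →+* K) {J : Matrix (Fin 3) (Fin 3) K}

/-! ## §1 TYPE B cells: Prop. 10 at a level `ν < N ≤ Np` with ONLY `|A − b| ≤ |ϖ^N|` (no exact order of the diagonal defect is read) -/

section TypeB

variable [IsDiscreteValuationRing 𝒪[K]] [Finite (ResidueField 𝒪[K])]

/-- **PROP. 10, TYPE B DISPATCHER** (trace corner `τ = !![A,0,B₂p; 0,b,0; B₂,0,D] ∈ H`, `|p| < 1`, `|B₂| = |ϖ^ν|`, diagonal defects close `|A − D| < |B₂|`): if the defect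
`A − b` is SMALL relative to the split level — `|A − b| ≤ |ϖ^N|` with `ν < N ≤ Np` — then the number of cosets `y ∈ P_H ⧸ (P_H ∩ H^K_m)` with `y⁻¹ τ y ∈ H^K_m` is
`iTen q ν Np m`: `m = 0 ↦ 1`, `ν < m ↦ 0` (★ (C3c) `natCard_cosets_eq_zero_of_lt_of_rel`), `2m ≤ ν ↦ [P_H : P_H ∩ H^K_m]` (★ `natCard_cosets_eq_index_of_le_of_rel`),
`m ≤ ν < 2m ↦ 0` (`max(|A − b|, |D − b|) < |B₂|`, ★ `natCard_cosets_eq_zero_of_max_lt_of_rel`); Flicker's fourth regime `ν = Np` cannot occur.  Prop. 8's index enters as the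
hypotheses `hidx0 ∕ hidx` (as in (C5)′ `natCard_cosets_eq_iTen_of_rel`).  NO exact order of `A − b` is read — this is the type-B half of the (V2) contract (LH4-plan WORD #50∕#52).
[cite: Flicker1998UnitaryFL, Prop. 10 pp. 85–86] -/
theorem natCard_cosets_eq_iTen_of_rel_of_le (hJ : J = (StdForm.antidiagonal 3).over K) (hd : UnramifiedLocalConjDatum σ ϖ) (h2 : (2 : K) ≠ 0)
    {y z : K} (hy : Valued.v y = 1) (hzv : Valued.v z ≤ 1) (hz : z + σ z + y * σ y = 0)
    {m ν N Np : ℕ}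
    {c um τ : ↥(unitaryGroupOfForm σ J)} (hc : ((c : GL (Fin 3) K) : Matrix (Fin 3) (Fin 3) K) = !![1, 0, 0; 0, -1, 0; 0, 0, 1])
    (hum : ((um : GL (Fin 3) K) : Matrix (Fin 3) (Fin 3) K) = !![ϖ ^ m, y, z * (ϖ ^ m)⁻¹; 0, 1, -σ y * (ϖ ^ m)⁻¹; 0, 0, (ϖ ^ m)⁻¹])
    {A B₁ B₂ D b p : K} (hB₁ : B₁ = B₂ * p) (hvp : Valued.v p < 1)
    (hτ : ((τ : GL (Fin 3) K) : Matrix (Fin 3) (Fin 3) K) = !![A, 0, B₁; 0, b, 0; B₂, 0, D])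
    (hτH : τ ∈ Subgroup.centralizer ({c} : Set ↥(unitaryGroupOfForm σ J)))
    (hB₂ : Valued.v B₂ = Valued.v (ϖ ^ ν)) (hsN : Valued.v (A - b) ≤ Valued.v (ϖ ^ N)) (hAD : Valued.v (A - D) < Valued.v B₂)
    (hνN : ν < N) (hNNp : N ≤ Np)
    {q : ℕ} (hq : Nat.card (ResidueField 𝒪[K]) = q ^ 2)
    (hidx0 : m = 0 → ((flickerHK σ J c um).subgroupOf (flickerPH σ J c)).index = 1)
    (hidx : 1 ≤ m → ((flickerHK σ J c um).subgroupOf (flickerPH σ J c)).index = (q ^ 2 - 1) * q ^ (4 * m - 2)) :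
    (Nat.card {w : ↥(flickerPH σ J c) ⧸ (flickerHK σ J c um).subgroupOf (flickerPH σ J c) //
      ((Quotient.out w : ↥(flickerPH σ J c)) : ↥(unitaryGroupOfForm σ J))⁻¹ * τ * (Quotient.out w : ↥(flickerPH σ J c)) ∈ flickerHK σ J c um} : ℚ) =
      iTen q ν Np m := by
  have hq0 : q ≠ 0 := by
    rintro rfl
    have h1 : 0 < Nat.card (ResidueField 𝒪[K]) := Nat.card_pos
    rw [hq] at h1; simp at h1
  have hϖ0 : ϖ ≠ 0 := hd.ϖ_ne_zero
  have hB₂0 : B₂ ≠ 0 := fun h => by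
    rw [h, map_zero] at hB₂; exact (pow_ne_zero _ hϖ0) ((map_eq_zero _).1 hB₂.symm)
  have hvmm : Valued.v (ϖ ^ m) * Valued.v (ϖ ^ m) = Valued.v (ϖ ^ (2 * m)) := by rw [← map_mul, ← pow_add, two_mul]
  -- `|A − b| < |B₂|` and `|D − b| < |B₂|`
  have hsν : Valued.v (A - b) < Valued.v B₂ := by
    rw [hB₂]; exact lt_of_le_of_lt hsN (by rw [v_pow_lt_v_pow_iff_of_unramified σ hd]; exact hνN)
  have hDb : D - b = (A - b) - (A - D) := by ring
  have hvD : Valued.v (D - b) ≤ max (Valued.v (A - b)) (Valued.v (A - D)) := by rw [hDb]; exact Valuation.map_sub _ _ _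
  have hDν : Valued.v (D - b) < Valued.v B₂ := lt_of_le_of_lt hvD (max_lt hsν hAD)
  rcases Nat.eq_zero_or_pos m with hm0 | hm
  · -- m = 0 : everything is integral, one coset
    subst hm0
    have h1 : Valued.v (ϖ ^ 0) * Valued.v (ϖ ^ 0) = 1 := by rw [pow_zero, map_one, one_mul]
    have hB₂1 : Valued.v B₂ ≤ 1 := by rw [hB₂]; exact hd.v_pow_le_one ν
    have hall := natCard_cosets_eq_index_of_le_of_rel σ hJ hd h2 hy hzv hz 0 hc hum hB₁ hvp.le hτ hτH
      (by rw [h1]; exact hsν.le.trans hB₂1) (by rw [h1]; exact hDν.le.trans hB₂1) (by rw [h1]; exact hB₂1)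
    rw [hall, hidx0 rfl, iTen, if_pos rfl, Nat.cast_one]
  have hm0 : m ≠ 0 := by omega
  by_cases hνm : ν < m
  · -- regime «m > ν» : empty
    rw [natCard_cosets_eq_zero_of_lt_of_rel σ hJ hd h2 hy hzv hz m hc hum hB₁ hvp hB₂0 hτ hτH
        (by rw [hB₂, v_pow_lt_v_pow_iff_of_unramified σ hd]; exact hνm),
      iTen, if_neg hm0, if_neg (by omega), if_neg (by omega), Nat.cast_zero]
  have hmν : m ≤ ν := by omega
  by_cases h2m : 2 * m ≤ ν
  · -- regime «all» : the full index (`2m ≤ ν < N ≤ Np`)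
    have hB₂m : Valued.v B₂ ≤ Valued.v (ϖ ^ m) * Valued.v (ϖ ^ m) := by
      rw [hvmm, hB₂, v_pow_le_v_pow_iff_of_unramified σ hd]; exact h2m
    have hall := natCard_cosets_eq_index_of_le_of_rel σ hJ hd h2 hy hzv hz m hc hum hB₁ hvp.le hτ hτH
      (hsν.le.trans hB₂m) (hDν.le.trans hB₂m) hB₂m
    rw [hall, hidx hm, cast_index_eq hq0 hm, iTen, if_neg hm0, if_pos (by omega)]
  · -- regime «m ≤ ν < 2m» : `|B₂|` dominates, no solution
    have hmax : max (Valued.v (A - b)) (Valued.v (D - b)) < Valued.v B₂ := max_lt hsν hDν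
    have hbig : Valued.v (ϖ ^ m) * Valued.v (ϖ ^ m) < Valued.v B₂ := by
      rw [hvmm, hB₂, v_pow_lt_v_pow_iff_of_unramified σ hd]; omega
    rw [natCard_cosets_eq_zero_of_max_lt_of_rel σ hJ hd h2 hy hzv hz m hc hum hB₁ hvp hB₂0 hτ hτH hmax hbig,
      iTen, if_neg hm0, if_neg (by omega), if_neg (by omega), Nat.cast_zero]

/-- **PROP. 10 AT THE TRACE LITERAL, TYPE B** (`1 ≤ j ≤ N ≤ Np`, `|E| ≤ |ϖ^N|`): for `t = M_{b,π₁,π₁′}(x₁,x₂,x₃)` (★ F1's trace torus block with a free level `|π₁| = |ϖ^j|`,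
`π₁π₁′ = 1`; the radial conjugates `r_i⁻¹ M_{b,ϖ} r_i` have `j = 2i + 1`), `|x₁ − x₃| = |ϖ^N|` and diagonal defect `E = (x₁ − x₂)σb + (x₃ − x₂)b` with ONLY `|E| ≤ |ϖ^N|`:
`#{y ∈ P_H ⧸ (P_H ∩ H^K_m) : y⁻¹ t y ∈ H^K_m} = iTen q (N − j) Np m` for EVERY `Np ≥ N` — the type-B twin of (C5)′ `natCard_cosets_traceTorus_eq_iTen_of_rel` (LH3-p01), with
Prop. 8's numbers DISCHARGED by ★ C2-C p852072 (`index_flickerHK_subgroupOf_flickerPH_eq{,_one}_of_rel`).  Tokens as there: `p := π₁²∕(bσb)`, `B₂ = π₁′bσb(x₁ − x₃)`,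
`|A − D| = |x₁ − x₃|·|σb − b| ≤ |ϖ^N| < |B₂|`. [cite: Flicker1998UnitaryFL, Prop. 10 pp. 85–86; Prop. 8 pp. 84–85] -/
theorem natCard_cosets_traceTorus_eq_iTen_of_rel_of_le (hJ : J = (StdForm.antidiagonal 3).over K) (hd : UnramifiedLocalConjDatum σ ϖ) (h2 : (2 : K) ≠ 0)
    (hσO : ∀ y : 𝒪[K], (σ.comp 𝒪[K].subtype) y ∈ 𝒪[K]) {y z : K} (hy : Valued.v y = 1) (hzv : Valued.v z ≤ 1) (hz : z + σ z + y * σ y = 0)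
    {m : ℕ} {c um t : ↥(unitaryGroupOfForm σ J)} (hc : ((c : GL (Fin 3) K) : Matrix (Fin 3) (Fin 3) K) = !![1, 0, 0; 0, -1, 0; 0, 0, 1])
    (hum : ((um : GL (Fin 3) K) : Matrix (Fin 3) (Fin 3) K) = !![ϖ ^ m, y, z * (ϖ ^ m)⁻¹; 0, 1, -σ y * (ϖ ^ m)⁻¹; 0, 0, (ϖ ^ m)⁻¹])
    {b π₁ π₁' x₁ x₂ x₃ : K} (hb : b + σ b = 1) (hbv : Valued.v b ≤ 1) (hππ : π₁ * π₁' = 1)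
    {j : ℕ} (hπj : Valued.v π₁ = Valued.v (ϖ ^ j))
    (hte : ((t : GL (Fin 3) K) : Matrix (Fin 3) (Fin 3) K) =
      !![x₁ * σ b + x₃ * b, 0, π₁ * (x₁ - x₃); 0, x₂, 0; π₁' * (b * σ b * (x₁ - x₃)), 0, x₁ * b + x₃ * σ b])
    (htH : t ∈ Subgroup.centralizer ({c} : Set ↥(unitaryGroupOfForm σ J)))
    {N Np : ℕ} (hN : Valued.v (x₁ - x₃) = Valued.v (ϖ ^ N)) (hNle : Valued.v ((x₁ - x₂) * σ b + (x₃ - x₂) * b) ≤ Valued.v (ϖ ^ N)) (hNNp : N ≤ Np)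
    (hj : 1 ≤ j) (hjN : j ≤ N)
    {q : ℕ} (hq : Nat.card (ResidueField 𝒪[K]) = q ^ 2)
    {a₀ : 𝒪[K]} (ha₀ : IsUnit (((σ.comp 𝒪[K].subtype).codRestrict 𝒪[K] hσO) a₀ - a₀)) :
    (Nat.card {w : ↥(flickerPH σ J c) ⧸ (flickerHK σ J c um).subgroupOf (flickerPH σ J c) //
      ((Quotient.out w : ↥(flickerPH σ J c)) : ↥(unitaryGroupOfForm σ J))⁻¹ * t * (Quotient.out w : ↥(flickerPH σ J c)) ∈ flickerHK σ J c um} : ℚ) =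
      iTen q (N - j) Np m := by
  have hϖ0 : ϖ ≠ 0 := hd.ϖ_ne_zero
  -- units: `b, σb, π₁, π₁′`
  obtain ⟨hvb, hvσb, hvbσb⟩ := v_eq_one_of_add_map_eq_one σ hd.vσ hbv hb
  have hb0 : b ≠ 0 := fun h => by rw [h, map_zero] at hvb; exact zero_ne_one hvb
  have hσb0 : σ b ≠ 0 := fun h => by rw [h, map_zero] at hvσb; exact zero_ne_one hvσb
  have hπ0 : π₁ ≠ 0 := fun h => by rw [h, zero_mul] at hππ; exact zero_ne_one hππ
  have hπ'e : π₁' = π₁⁻¹ := eq_inv_of_mul_eq_one_right hππ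
  -- the generic tokens: `p := π₁²∕(bσb)`
  have hB₁ : π₁ * (x₁ - x₃) = π₁' * (b * σ b * (x₁ - x₃)) * (π₁ * π₁ / (b * σ b)) := by
    have hbb : b * σ b ≠ 0 := mul_ne_zero hb0 hσb0
    rw [mul_div_assoc', eq_div_iff hbb]
    linear_combination (-((x₁ - x₃) * (b * σ b) * π₁)) * hππ
  have hvp : Valued.v (π₁ * π₁ / (b * σ b)) < 1 := by
    rw [map_div₀, map_mul, hvbσb, div_one, hπj, ← map_mul, ← pow_add]
    exact hd.v_pow_le_one _ |>.lt_of_ne (by rw [Ne, hd.v_pow, ← WithZero.exp_zero, WithZero.exp_inj]; omega)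
  have hB₂ : Valued.v (π₁' * (b * σ b * (x₁ - x₃))) = Valued.v (ϖ ^ (N - j)) := by
    rw [map_mul, map_mul, hvbσb, one_mul, hπ'e, map_inv₀, hπj, hN, hd.v_pow, hd.v_pow, hd.v_pow, ← WithZero.exp_neg, ← WithZero.exp_add]
    congr 1
    push_cast [Nat.cast_sub hjN]
    ring
  have hs : Valued.v (x₁ * σ b + x₃ * b - x₂) ≤ Valued.v (ϖ ^ N) := by
    rw [show x₁ * σ b + x₃ * b - x₂ = (x₁ - x₂) * σ b + (x₃ - x₂) * b by linear_combination x₂ * hb]; exact hNle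
  have hAD : Valued.v ((x₁ * σ b + x₃ * b) - (x₁ * b + x₃ * σ b)) < Valued.v (π₁' * (b * σ b * (x₁ - x₃))) := by
    rw [show (x₁ * σ b + x₃ * b) - (x₁ * b + x₃ * σ b) = (x₁ - x₃) * (σ b - b) by ring, map_mul, hB₂, hN]
    have hsb : Valued.v (σ b - b) ≤ 1 := le_trans (Valuation.map_sub _ _ _) (max_le hvσb.le hvb.le)
    calc Valued.v (ϖ ^ N) * Valued.v (σ b - b) ≤ Valued.v (ϖ ^ N) * 1 := by gcongr
      _ = Valued.v (ϖ ^ N) := mul_one _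
      _ < Valued.v (ϖ ^ (N - j)) := by rw [v_pow_lt_v_pow_iff_of_unramified σ hd]; omega
  -- Prop. 8's index (★ C2-C)
  have hidx0 : m = 0 → ((flickerHK σ J c um).subgroupOf (flickerPH σ J c)).index = 1 := by
    rintro rfl
    exact index_flickerHK_subgroupOf_flickerPH_eq_one_of_rel σ hJ hd h2 hy hzv hz hσO hum hc hq ha₀
  have hidx : 1 ≤ m → ((flickerHK σ J c um).subgroupOf (flickerPH σ J c)).index = (q ^ 2 - 1) * q ^ (4 * m - 2) :=
    fun hm => index_flickerHK_subgroupOf_flickerPH_eq_of_rel σ hJ hd h2 hy hzv hz hσO hm hum hc hq ha₀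
  exact natCard_cosets_eq_iTen_of_rel_of_le σ hJ hd h2 hy hzv hz hc hum hB₁ hvp hte htH hB₂ hs hAD (by omega) hNNp hq hidx0 hidx

end TypeB

/-! ## §2 THE θ̄ = 1 VALUE under the (V2) regime datum -/

section ThetaOne

variable [IsDiscreteValuationRing 𝒪[K]] [Finite (ResidueField 𝒪[K])] [IsAdicComplete (maximalIdeal 𝒪[K]) 𝒪[K]]

set_option maxHeartbeats 800000 in
set_option synthInstance.maxHeartbeats 200000 in
-- the `H`-action on `H ⧸ (K^{u_m} ∩ H)` is found through the large subgroup terms of the `U(2,1)` frame (as in ★ (F2) ∕ ★ `…ValueThetaOne`)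
/-- **LAYER C, `θ̄ = 1`, TRACE FRAME — THE VALUE `#Fix_{U⧸K}(t) = phiOne q Np N` UNDER THE (V2) REGIME DATUM.**  `U = U(σ, Φ₃)(K)`, `K₀ = unitaryInt`, `H = Z_U(c)`,
`c = diag(1,−1,1)`; `t = !![x₁σb + x₃b, 0, θ(x₁ − x₃); 0, x₂, 0; θ′bσb(x₁ − x₃), 0, x₁b + x₃σb]` (★ F1's trace torus block at `θ = ϖ`, `θ′ = ϖ⁻¹`; `b + σb = 1`, `|b| ≤ 1`;
norm-one `xᵢ`), `N = ord(x₁ − x₃)`, diagonal defect `E = (x₁ − x₂)σb + (x₃ − x₂)b`; level elements `u m = u_m^{(yℓ,zℓ)}` (★ p851802∕p851996 currency); lattice bridge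
`(R, ι, σR)` with T1 generator `gR` (`σR gR − gR ∈ Rˣ`), uniformiser `ϖR`, `#k_R = #k_K = q²`; radial representatives `r i = diag(ϖ^{−i}, 1, ϖ^i) ∈ H`; finitely many fixed
points.  REGIME DATUM (V2): `(N₁ < N ∧ N₂ = N₁ ∧ Np = N₁ ∧ |E| = |ϖ^{N₁}|) ∨ (N ≤ N₁ ∧ N ≤ Np ∧ |E| ≤ |ϖ^N|)`.  THEN `#{x ∈ U⧸K₀ : t x = x} = phiOne q Np N` in `ℚ` —
Flicker's Prop. 11 (first half) value, VERBATIM, at every residue characteristic.  PROOF: ★ (C0a) Prop. 5 unfolding over the `H u_m K₀`; at level `m`, Cor. 9 at the trace torus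
(★ C4-2, weights `1, (q+1)q^{j−1}` verbatim, `(flickerHK c (u m)).subgroupOf H = ((K₀).map (conj (u m))).subgroupOf H` by ★ `subgroupOf_flickerHK_eq`); the cell of index `i`
is Prop. 10 at the radial conjugate `r_i⁻¹ t r_i = M_{b, θϖ^{2i}, θ′ϖ^{−2i}}` (★ `coe_radial_inv_mul_traceTorusBlock_mul_radial`), level `j = 2i + 1`: for `j ≤ N` its count is
`iTen q (N − j) Np m` (TYPE A: (C5)′ `natCard_cosets_traceTorus_eq_iTen_of_rel_of_package` at the exact order `Np = N₁`; TYPE B: §1 `natCard_cosets_traceTorus_eq_iTen_of_rel_of_le`),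
for `j > N` it is `0` (★ `natCard_cosets_traceTorus_eq_zero_of_lt`); re-index `j = 2i + 1` (★ `finsum_comp_two_mul_add_one_eq_finsum_ite`) and sum with ★
`finsum_natCast_eq_phiOne`.  Twin of ★ `natCard_fixedPoints_unitaryInt_flickerTorus_eq_phiOne_of_bridge` (A-p03); the bridge that F0P3a-p02 (g23)'s `…ValueThetaOneCornerTrace`
consumes. [cite: Flicker1998UnitaryFL, Prop. 5 p. 82, Cor. 9 p. 85, Prop. 10 pp. 85–86, Prop. 11 p. 87] -/
theorem natCard_fixedPoints_unitaryInt_traceTorusPi_eq_phiOne_of_bridge (hJ : J = (StdForm.antidiagonal 3).over K)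
    (hd : UnramifiedLocalConjDatum σ ϖ) (h2 : (2 : K) ≠ 0) (hσO : ∀ y : 𝒪[K], (σ.comp 𝒪[K].subtype) y ∈ 𝒪[K])
    {c : ↥(unitaryGroupOfForm σ J)} (hc : ((c : GL (Fin 3) K) : Matrix (Fin 3) (Fin 3) K) = !![1, 0, 0; 0, -1, 0; 0, 0, 1])
    (u : ℕ → ↥(unitaryGroupOfForm σ J)) {yℓ zℓ : K} (hyℓ : Valued.v yℓ = 1) (hzℓ : Valued.v zℓ ≤ 1) (hyz : zℓ + σ zℓ + yℓ * σ yℓ = 0)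
    (hu : ∀ m, ((u m : GL (Fin 3) K) : Matrix (Fin 3) (Fin 3) K) = !![ϖ ^ m, yℓ, zℓ * (ϖ ^ m)⁻¹; 0, 1, -σ yℓ * (ϖ ^ m)⁻¹; 0, 0, (ϖ ^ m)⁻¹])
    {R : Type u} [CommRing R] [IsDomain R] [IsDiscreteValuationRing R] [Finite (ResidueField R)] (ι : R →+* K) (hι : Function.Injective ι)
    (hιv : ∀ x : K, Valued.v x ≤ 1 ↔ x ∈ Set.range ι) (σR : R →+* R) (hσR : ∀ r, σR (σR r) = r) (hσι : ∀ r, ι (σR r) = σ (ι r))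
    {gR : R} (hgR : IsUnit (σR gR - gR)) {ϖR : R} (hϖR : Irreducible ϖR) (hιϖ : ι ϖR = ϖ)
    {t : ↥(unitaryGroupOfForm σ J)} {b θ θ' x₁ x₂ x₃ : K} (hb : b + σ b = 1) (hbv : Valued.v b ≤ 1)
    (hθ : θ = ϖ ^ 1) (hθ' : θ' = (ϖ ^ 1)⁻¹) (hx₁ : σ x₁ * x₁ = 1) (hx₂ : σ x₂ * x₂ = 1) (hx₃ : σ x₃ * x₃ = 1)
    (hte : ((t : GL (Fin 3) K) : Matrix (Fin 3) (Fin 3) K) =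
      !![x₁ * σ b + x₃ * b, 0, θ * (x₁ - x₃); 0, x₂, 0; θ' * (b * σ b * (x₁ - x₃)), 0, x₁ * b + x₃ * σ b])
    (htH : t ∈ Subgroup.centralizer ({c} : Set ↥(unitaryGroupOfForm σ J)))
    (r : ℕ → ↥(Subgroup.centralizer ({c} : Set ↥(unitaryGroupOfForm σ J))))
    (hr : ∀ i, (((r i : ↥(unitaryGroupOfForm σ J)) : GL (Fin 3) K) : Matrix (Fin 3) (Fin 3) K) = !![(ϖ ^ i)⁻¹, 0, 0; 0, 1, 0; 0, 0, ϖ ^ i])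
    {N Np N₁ N₂ : ℕ} (hN : Valued.v (x₁ - x₃) = Valued.v (ϖ ^ N))
    (h : (N₁ < N ∧ N₂ = N₁ ∧ Np = N₁ ∧ Valued.v ((x₁ - x₂) * σ b + (x₃ - x₂) * b) = Valued.v (ϖ ^ N₁)) ∨
      (N ≤ N₁ ∧ N ≤ Np ∧ Valued.v ((x₁ - x₂) * σ b + (x₃ - x₂) * b) ≤ Valued.v (ϖ ^ N)))
    {q : ℕ} (hq : Nat.card (ResidueField 𝒪[K]) = q ^ 2) (hqR : Nat.card (ResidueField R) = q ^ 2) (hq1 : 1 < q)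
    {a₀ : 𝒪[K]} (ha₀ : IsUnit (((σ.comp 𝒪[K].subtype).codRestrict 𝒪[K] hσO) a₀ - a₀))
    (hfin : {x : ↥(unitaryGroupOfForm σ J) ⧸ unitaryInt σ J | t • x = x}.Finite) :
    (Nat.card {x : ↥(unitaryGroupOfForm σ J) ⧸ unitaryInt σ J | t • x = x} : ℚ) = phiOne q Np N := by
  have hϖ0 : ϖ ≠ 0 := hd.ϖ_ne_zero
  have hθθ' : θ * θ' = 1 := by rw [hθ, hθ']; exact mul_inv_cancel₀ (pow_ne_zero _ hϖ0)
  have hσθ : σ θ = θ := by rw [hθ, map_pow, hd.σϖ]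
  have hvθ : Valued.v θ = Valued.v (ϖ ^ 1) := by rw [hθ]
  have h13 : x₁ ≠ x₃ := by
    intro h0; rw [h0, sub_self, map_zero] at hN; exact (pow_ne_zero _ hϖ0) ((map_eq_zero _).1 hN.symm)
  have hr' : ∀ i, (((r i : ↥(unitaryGroupOfForm σ J)) : GL (Fin 3) K) : Matrix (Fin 3) (Fin 3) K) = !![ϖ⁻¹ ^ i, 0, 0; 0, 1, 0; 0, 0, ϖ ^ i] :=
    fun i => by rw [hr i, inv_pow]
  -- the radial conjugates are trace torus blocks with level `2i + 1`
  have hconj : ∀ i, ((((r i : ↥(unitaryGroupOfForm σ J)))⁻¹ * t * (r i : ↥(unitaryGroupOfForm σ J)) : GL (Fin 3) K) : Matrix (Fin 3) (Fin 3) K) =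
      !![x₁ * σ b + x₃ * b, 0, (θ * (ϖ ^ i * ϖ ^ i)) * (x₁ - x₃); 0, x₂, 0;
        (θ' * (ϖ⁻¹ ^ i * ϖ⁻¹ ^ i)) * (b * σ b * (x₁ - x₃)), 0, x₁ * b + x₃ * σ b] :=
    fun i => coe_radial_inv_mul_traceTorusBlock_mul_radial σ hϖ0 i hte (hr' i)
  have hconjH : ∀ i, ((r i : ↥(unitaryGroupOfForm σ J)))⁻¹ * t * (r i : ↥(unitaryGroupOfForm σ J)) ∈
      Subgroup.centralizer ({c} : Set ↥(unitaryGroupOfForm σ J)) :=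
    fun i => Subgroup.mul_mem _ (Subgroup.mul_mem _ (Subgroup.inv_mem _ (r i).2) htH) (r i).2
  -- the count of one summand, as `ℚ`
  set C : ℕ → ℕ → ℕ := fun i m => Nat.card {w : ↥(flickerPH σ J c) ⧸ (flickerHK σ J c (u m)).subgroupOf (flickerPH σ J c) //
      ((Quotient.out w : ↥(flickerPH σ J c)) : ↥(unitaryGroupOfForm σ J))⁻¹ *
        (((r i : ↥(unitaryGroupOfForm σ J)))⁻¹ * t * (r i : ↥(unitaryGroupOfForm σ J))) * (Quotient.out w : ↥(flickerPH σ J c)) ∈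
        flickerHK σ J c (u m)} with hC
  have hCpos : ∀ i m, 2 * i + 1 ≤ N → (C i m : ℚ) = iTen q (N - (2 * i + 1)) Np m := by
    intro i m hi
    rcases h with ⟨-, -, hNp₁, hE⟩ | ⟨-, hNNp, hEle⟩
    · -- TYPE A: the defect has the exact order `Np = N₁`
      rw [hNp₁]
      exact natCard_cosets_traceTorus_eq_iTen_of_rel_of_package σ hJ hd h2 hσO hyℓ hzℓ hyz hc (hu m) hb hbv
        (radialPair_mul_eq_one hϖ0 hθθ' i) (map_radialPair_fst σ hd.σϖ hσθ i) (v_radialPair_fst hvθ i) hx₁ hx₂ hx₃ (hconj i) (hconjH i)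
        hN hE (by omega) hi hq ha₀
    · -- TYPE B: only `|E| ≤ |ϖ^N|`, `N ≤ Np`
      exact natCard_cosets_traceTorus_eq_iTen_of_rel_of_le σ hJ hd h2 hσO hyℓ hzℓ hyz hc (hu m) hb hbv
        (radialPair_mul_eq_one hϖ0 hθθ' i) (v_radialPair_fst hvθ i) (hconj i) (hconjH i) hN hEle hNNp (by omega) hi hq ha₀
  have hCbig : ∀ i m, N < 2 * i + 1 → C i m = 0 := fun i m hi =>
    natCard_cosets_traceTorus_eq_zero_of_lt σ hJ hd h2 hyℓ hyz hc (hu m) hb hbv (θbar := 1) hθ' hte (hr' i) hN hi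
  -- the values-abstract `I`
  set I : ℕ → ℕ → ℚ := fun j m => if j ≤ N then iTen q (N - j) Np m else 0 with hI
  have hpos : ∀ j m, 1 ≤ j → j ≤ N → I j m = iTen q (N - j) Np m := fun j m _ hj => by rw [hI]; exact if_pos hj
  have hbig : ∀ j m, N < j → I j m = 0 := fun j m hj => by rw [hI]; exact if_neg (by omega)
  -- the level-`m` count `A m`
  set A : ℕ → ℕ := fun m => Nat.card {z : ↥(Subgroup.centralizer ({c} : Set ↥(unitaryGroupOfForm σ J))) ⧸
      ((unitaryInt σ J).map (MulAut.conj (u m)).toMonoidHom).subgroupOf (Subgroup.centralizer ({c} : Set ↥(unitaryGroupOfForm σ J))) |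
    (⟨t, htH⟩ : ↥(Subgroup.centralizer ({c} : Set ↥(unitaryGroupOfForm σ J)))) • z = z} with hAdef
  have hsuppC : ∀ m, (Function.support fun i : ℕ => (if 2 * i + 1 = 0 then 1 else (q + 1) * q ^ (2 * i + 1 - 1)) * C i m).Finite := by
    intro m
    refine (Set.finite_Iio N).subset fun i hi => ?_
    by_contra hle
    simp only [Set.mem_Iio, not_lt] at hle
    exact hi (by dsimp only; rw [hCbig i m (by omega), mul_zero])
  -- Cor. 9 at level `m` (★ C4-2), in the (F2) quotient currency
  have hC9 : ∀ m, A m = ∑ᶠ i : ℕ, (if 2 * i + 1 = 0 then 1 else (q + 1) * q ^ (2 * i + 1 - 1)) * C i m := by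
    intro m
    have hS := subgroupOf_flickerHK_eq σ c (u m)
    have hfinm : {x : ↥(Subgroup.centralizer ({c} : Set ↥(unitaryGroupOfForm σ J))) ⧸
        (flickerHK σ J c (u m)).subgroupOf (Subgroup.centralizer ({c} : Set ↥(unitaryGroupOfForm σ J))) |
          (⟨t, htH⟩ : ↥(Subgroup.centralizer ({c} : Set ↥(unitaryGroupOfForm σ J)))) • x = x}.Finite := by
      rw [hS]; exact Set.finite_coe_iff.1 ((finite_setOf_nonempty_fixedPoints_flickerU_of_rel σ hJ hd h2 hyℓ hzℓ hyz hc u hu htH hfin).2 m)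
    have h9 := natCard_fixedPoints_traceTorus_eq_finsum σ hJ hd h2 hyℓ hzℓ hyz m (hu m) ι hι hιv σR hσR hσι hgR hϖR hιϖ hqR hc
      (ε := 1) le_rfl hθθ' hθ hb hbv htH hte h13 r hr hfinm
    rw [hS] at h9
    rw [hAdef]
    exact h9
  have hA : ∀ m, (A m : ℚ) = ∑ᶠ j, (if j % 2 = 1 then corNineWeight q j * I j m else 0) := by
    intro m
    have hcastC := (Nat.castAddMonoidHom ℚ).map_finsum (hsuppC m)
    simp only [Nat.coe_castAddMonoidHom] at hcastC
    rw [hC9 m, hcastC, ← Rogawski1990.Flicker1998.finsum_comp_two_mul_add_one_eq_finsum_ite]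
    refine finsum_congr fun i => ?_
    rw [Nat.cast_mul, Rogawski1990.Flicker1998.natCast_weight_eq_corNineWeight hq1.le (2 * i + 1)]
    by_cases hi : 2 * i + 1 ≤ N
    · rw [hpos _ m (by omega) hi, ← hCpos i m hi]
    · rw [hbig _ m (by omega), hCbig i m (by omega), Nat.cast_zero]
  have hsuppA : (Function.support A).Finite := by
    refine (finite_setOf_nonempty_fixedPoints_flickerU_of_rel σ hJ hd h2 hyℓ hzℓ hyz hc u hu htH hfin).1.subset fun m hm => ?_
    by_contra hne
    apply hm
    rw [hAdef]; dsimp only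
    simp only [Set.mem_setOf_eq, not_nonempty_iff] at hne
    exact @Nat.card_of_isEmpty _ hne
  have hcast := (Nat.castAddMonoidHom ℚ).map_finsum hsuppA
  simp only [Nat.coe_castAddMonoidHom] at hcast
  rw [natCard_fixedPoints_unitaryInt_eq_finsum_flickerU_of_rel σ hJ hd h2 hyℓ hzℓ hyz hc u hu htH hfin]
  change ((∑ᶠ m, A m : ℕ) : ℚ) = _
  rw [hcast]
  exact Rogawski1990.Flicker1998.finsum_natCast_eq_phiOne q I hpos hbig hq1 A hA

end ThetaOne

end UnitaryGroup

end Literature.NumberTheory.Automorphic
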